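import Literature.NumberTheory.EllipticCurves.ConjugatePairingDuality
import Literature.NumberTheory.GaloisRepresentations.LocalGlobalCohomologyDualityProofs
import Mathlib.LinearAlgebra.Quotient.Card
import HarnessLib

/-!
# A maximal isotropic subgroup of half size is its own exact orthogonal complement; the conjugate pairing
# `ẽ(a, b) = e(a, θ b)` restricted to `Fil × M/Fil′` is perfect (finite abelian groups; theorems only)

`Proofs` file (theorems only; no definition, no named fact, no instance, no `sorry`).  Topic `NumberTheory/EllipticCurves`
(companion of `ConjugatePairingDuality` — Howard's `(s, t) ↦ e(s, t^τ)`, Rem. 1.3.2 — and of `TorsionFilAtCyclicOrdinaryProofs`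
(isotropy of `Fil_v E[p^k]`); cell `pub/bsd-print-x9`, brick (B3) of `HOME/p1/H4-EXACT-AT-P-PLAN`).

Howard [Compositio Math. 140 (2004), Lemma 3.1.1, arXiv:1202.6340 p. 15 L60–62]: «The submodule `Fil_v(T_𝔭) ⊂ T_𝔭` is its own
exact orthogonal complement under the pairing `e_𝔭`.»  The `E`-level content is elementary finite-group duality: for a perfect
pairing `e : M × M → ℤ/n` on a finite `n`-torsion group and an isotropic `A ≤ M` with `#A² = #M`, `A^⊥ = A`; and then, for an
involution `θ` carrying `A′` onto `A`, the conjugate pairing `ẽ(a, b) = e(a, θ b)` has `A^{⊥,ẽ} = A′` and every character of `A`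
is `ẽ(·, b)|_A` — i.e. `ẽ` induces a PERFECT pairing `A × M/A′ → ℤ/n` (the inputs (E-R)/(E-S) of
`ZpExtension.mem_span_tmul_of_forall_tailFormZMod_eisensteinDualityForm_eq_zero` /
`exists_forall_tailFormZMod_eisensteinDualityForm_eq_of_mem_span_tmul`, at `M = E[p^k]`, `A = Fil_v`, `A′ = δ_v Fil_v̄`, `θ = τ_*`).

* §1 `Submodule.natCard_orthogonal_le` — `#A^⊥ ≤ #(M/A)` for a right-non-degenerate `e` (`A^⊥ ↪ Hom(M/A, ℤ/n)`, and
  `#Hom(M/A, ℤ/n) = #(M/A)`, tree `Nat.card_addMonoidHom_zmod`); **`Submodule.mem_of_forall_mem_eq_zero_of_sq`** — `A^⊥ = A` for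
  `A` isotropic with `#A · #A = #M`;
* §2 **`conjPairing_restricted_right_exact`** ((E-R): `(∀ a ∈ A, ẽ(a, b) = 0) → b ∈ A′`) and
  **`conjPairing_restricted_right_exhausting`** ((E-S): every `φ : A →+ ℤ/n` is `ẽ(·, b)|_A`, by counting `#M = #A′ · #Hom(A, ℤ/n)`),
  plus `conjPairing_restricted_eq_zero` ((E-orth)).

Pure finite abelian groups; the curve instance (`#Fil_v E[p^k] = p^k`, `τ_* δ_v Fil_v̄ = Fil_v`) is the next file.  No summit statement
is proved; BSD is not proved by any of this.  Seat `bsd-line-x10b-p1-w7` g2.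

References: [Howard2004HeegnerKolyvagin] Rem. 1.3.2, Lemma 3.1.1 (arXiv:1202.6340 p. 7 L81–88, p. 15 L60–62); [MilneADT2006] I §0
Prop. 0.19 (finite duality); [SilvermanAEC2009] III.8.1 (the Weil pairing is perfect and alternating).
-/

noncomputable section

open Function

namespace Literature.NumberTheory.EllipticCurves

open Literature.NumberTheory.GaloisRepresentations

section Orthogonal

variable {M : Type*} [AddCommGroup M] [Finite M] {n : ℕ} [NeZero n] (e : M →+ M →+ ZMod n) (A : Submodule ℤ M)

/-! ## §1 The exact orthogonal complement of a half-size isotropic subgroup -/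

/-- **`#A^⊥ ≤ #(M/A)`**: for a RIGHT non-degenerate `e : M × M → ℤ/n` on an `n`-torsion group, the right orthogonal
`A^⊥ = {b | e(A, b) = 0}` embeds into `Hom(M/A, ℤ/n)` (`b ↦ e(·, b)` descended), a group of order `#(M/A)`.
[cite: MilneADT2006, I §0 Prop. 0.19 (finite duality)] -/
theorem Submodule.natCard_orthogonal_le (hM : ∀ x : M, n • x = 0) (hnd : ∀ b : M, (∀ a : M, e a b = 0) → b = 0)
    (B : Submodule ℤ M) (hB : ∀ b ∈ B, ∀ a ∈ A, e a b = 0) : Nat.card B ≤ Nat.card (M ⧸ A) := by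
  haveI : Finite (M ⧸ A) := Finite.of_surjective _ (Submodule.mkQ_surjective A)
  have hq : ∀ q : M ⧸ A, n • q = 0 := fun q ↦ by
    induction q using Submodule.Quotient.induction_on with
    | _ x => rw [← Submodule.mkQ_apply, ← map_nsmul, hM, map_zero]
  have hHq := Nat.card_addMonoidHom_zmod hq
  haveI : Finite (M ⧸ A →+ ZMod n) := Nat.finite_of_card_ne_zero (by rw [hHq]; exact Nat.card_pos.ne')
  rw [← hHq]
  -- `b ↦ (x̄ ↦ e x b)`
  let Ψ : B → (M ⧸ A →+ ZMod n) := fun b ↦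
    (A.liftQ (e.flip (b : M)).toIntLinearMap fun a ha ↦ by
      change e a b = 0
      exact hB b b.2 a ha).toAddMonoidHom
  have hΨ : ∀ (b : B) (x : M), Ψ b (Submodule.Quotient.mk x) = e x b := fun b x ↦ rfl
  refine Nat.card_le_card_of_injective Ψ fun b b' h ↦ Subtype.ext ?_
  rw [← sub_eq_zero]
  refine hnd _ fun a ↦ ?_
  rw [map_sub, ← hΨ b a, ← hΨ b' a, h, sub_self]

/-- **A maximal isotropic subgroup of half size is its own exact orthogonal complement** (Howard's Lemma 3.1.1 at the
`E`-level): for `e : M × M → ℤ/n` right non-degenerate on a finite `n`-torsion `M`, an isotropic `A` with `#A · #A = #M` contains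
every `b` with `e(a, b) = 0` for all `a ∈ A`. [cite: Howard2004HeegnerKolyvagin, Lemma 3.1.1 (arXiv:1202.6340 p. 15, L60–62)]
[cite: MilneADT2006, I §0 Prop. 0.19] -/
theorem Submodule.mem_of_forall_mem_eq_zero_of_sq (hM : ∀ x : M, n • x = 0) (hnd : ∀ b : M, (∀ a : M, e a b = 0) → b = 0)
    (hiso : ∀ a ∈ A, ∀ a' ∈ A, e a a' = 0) (hcard : Nat.card A * Nat.card A = Nat.card M)
    {b : M} (hb : ∀ a ∈ A, e a b = 0) : b ∈ A := by
  classical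
  -- the right orthogonal `A^⊥` as a submodule
  let B : Submodule ℤ M :=
    { carrier := {b | ∀ a ∈ A, e a b = 0}
      zero_mem' := fun a _ ↦ by rw [map_zero]
      add_mem' := fun {x y} hx hy a ha ↦ by rw [map_add, hx a ha, hy a ha, add_zero]
      smul_mem' := fun c {x} hx a ha ↦ by rw [map_zsmul, hx a ha, smul_zero] }
  have hAB : A ≤ B := fun a' ha' a ha ↦ hiso a ha a' ha'
  have hBle : Nat.card B ≤ Nat.card (M ⧸ A) := Submodule.natCard_orthogonal_le e A hM hnd B fun b hb' a ha ↦ hb' a ha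
  have hquot : Nat.card (M ⧸ A) = Nat.card A := by
    have h := Submodule.card_eq_card_quotient_mul_card A
    rw [← hcard] at h
    exact (Nat.eq_of_mul_eq_mul_left Nat.card_pos h).symm
  have hle : Nat.card B ≤ Nat.card A := hBle.trans hquot.le
  have hEq : A.toAddSubgroup = B.toAddSubgroup :=
    AddSubgroup.eq_of_le_of_card_ge (fun x hx ↦ hAB hx) hle
  have hbB : b ∈ B.toAddSubgroup := hb
  rw [← hEq] at hbB
  exact hbB

end Orthogonal

/-! ## §2 The conjugate pairing `ẽ(a, b) = e(a, θ b)` restricted to `A × M/A′` is perfect -/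

section Conjugate

variable {M : Type*} [AddCommGroup M] [Finite M] {n : ℕ} [NeZero n] (e : M →+ M →+ ZMod n) (θ : M →+ M)
  (A A' : Submodule ℤ M)
  (hθ : ∀ x ∈ A', θ x ∈ A) (hθ' : ∀ y ∈ A, ∃ x ∈ A', θ x = y) (hθθ : ∀ x, θ (θ x) = x)

omit [Finite M] [NeZero n] in
include hθ in
/-- (E-orth) **`ẽ(A, A′) = 0`**: `e(a, θ b) = 0` for `a ∈ A`, `b ∈ A′` when `θ(A′) ⊆ A` and `A` is `e`-isotropic.
[cite: Howard2004HeegnerKolyvagin, Rem. 1.3.2 and Lemma 3.1.1 (arXiv p. 7 L81–88, p. 15 L60–62)] -/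
theorem conjPairing_restricted_eq_zero (hiso : ∀ a ∈ A, ∀ a' ∈ A, e a a' = 0) {a : M} (ha : a ∈ A) {b : M} (hb : b ∈ A') :
    e a (θ b) = 0 :=
  hiso a ha (θ b) (hθ b hb)

include hθ' hθθ in
/-- (E-R) **The right `ẽ`-orthogonal of `A` is exactly `A′`**: if `e(a, θ b) = 0` for every `a ∈ A` then `b ∈ A′` — from `A^⊥ = A`
(`Submodule.mem_of_forall_mem_eq_zero_of_sq`), `θ(A′) = A` onto, and `θ` involutive.
[cite: Howard2004HeegnerKolyvagin, Lemma 3.1.1 (arXiv:1202.6340 p. 15, L60–62)] [cite: MilneADT2006, I §0 Prop. 0.19] -/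
theorem conjPairing_restricted_right_exact (hM : ∀ x : M, n • x = 0) (hnd : ∀ b : M, (∀ a : M, e a b = 0) → b = 0)
    (hiso : ∀ a ∈ A, ∀ a' ∈ A, e a a' = 0) (hcard : Nat.card A * Nat.card A = Nat.card M)
    {b : M} (hb : ∀ a ∈ A, e a (θ b) = 0) : b ∈ A' := by
  have hθb : θ b ∈ A := Submodule.mem_of_forall_mem_eq_zero_of_sq e A hM hnd hiso hcard hb
  obtain ⟨x, hx, hxb⟩ := hθ' (θ b) hθb
  have : x = b := by rw [← hθθ x, hxb, hθθ]
  exact this ▸ hx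

include hθ hθ' hθθ in
/-- (E-S) **Every character of `A` is `ẽ(·, b)|_A`**: for `φ : A →+ ℤ/n` there is `b ∈ M` with `e(a, θ b) = φ a` for all `a ∈ A`
— counting: the kernel of `b ↦ ẽ(·, b)|_A` is `A′` ((E-R)/(E-orth)), of order `#A` (`θ : A′ ≅ A`), so the image has order
`#M / #A = #A = #Hom(A, ℤ/n)`. [cite: Howard2004HeegnerKolyvagin, Lemma 3.1.1 and §1.3 H.4 («perfect») (arXiv p. 15 L60–62, p. 7 L69–72)]
[cite: MilneADT2006, I §0 Prop. 0.19] -/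
theorem conjPairing_restricted_right_exhausting (hM : ∀ x : M, n • x = 0) (hnd : ∀ b : M, (∀ a : M, e a b = 0) → b = 0)
    (hiso : ∀ a ∈ A, ∀ a' ∈ A, e a a' = 0) (hcard : Nat.card A * Nat.card A = Nat.card M) (φ : A →+ ZMod n) :
    ∃ b : M, ∀ a : A, e (a : M) (θ b) = φ a := by
  classical
  -- the map `b ↦ ẽ(·, b)|_A`
  let Ψ : M →+ (A →+ ZMod n) :=
    { toFun := fun b ↦ ((e.flip (θ b)).comp A.subtype.toAddMonoidHom)
      map_zero' := by ext a; simp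
      map_add' := fun b b' ↦ by ext a; simp }
  have hΨ : ∀ (b : M) (a : A), Ψ b a = e (a : M) (θ b) := fun b a ↦ rfl
  -- its kernel is `A′`
  have hker : ∀ b, Ψ b = 0 ↔ b ∈ A' := fun b ↦ by
    constructor
    · intro h
      refine conjPairing_restricted_right_exact e θ A A' hθ' hθθ hM hnd hiso hcard fun a ha ↦ ?_
      have := DFunLike.congr_fun h ⟨a, ha⟩
      rwa [hΨ] at this
    · intro hb
      ext a
      rw [hΨ, AddMonoidHom.zero_apply]
      exact conjPairing_restricted_eq_zero e θ A A' hθ hiso a.2 hb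
  -- `#A′ = #A` via `θ`
  have hA' : Nat.card A' = Nat.card A := by
    refine Nat.card_eq_of_bijective (fun x : A' ↦ (⟨θ x, hθ x x.2⟩ : A)) ⟨fun x y h ↦ ?_, fun y ↦ ?_⟩
    · apply Subtype.ext
      have h' : θ (x : M) = θ (y : M) := congrArg Subtype.val h
      rw [← hθθ (x : M), h', hθθ]
    · obtain ⟨x, hx, hxy⟩ := hθ' y y.2
      exact ⟨⟨x, hx⟩, Subtype.ext hxy⟩
  -- counting: `#range Ψ = #M / #A′ = #A = #Hom(A, ℤ/n)`
  have hA0 : ∀ a : A, n • a = 0 := fun a ↦ Subtype.ext (by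
    rw [Submodule.coe_smul_of_tower, Submodule.coe_zero]; exact hM a)
  have hHom : Nat.card (A →+ ZMod n) = Nat.card A := Nat.card_addMonoidHom_zmod hA0
  have hkerEq : Ψ.ker = A'.toAddSubgroup := by
    ext b
    rw [AddMonoidHom.mem_ker, hker]
    rfl
  have hrange : Nat.card Ψ.range * Nat.card A' = Nat.card M := by
    have h1 := Ψ.ker.card_eq_card_quotient_mul_card_addSubgroup
    have h2 : Nat.card (M ⧸ Ψ.ker) = Nat.card Ψ.range := Nat.card_congr (QuotientAddGroup.quotientKerEquivRange Ψ).toEquiv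
    rw [h2, hkerEq] at h1
    exact h1.symm
  have hcardR : Nat.card Ψ.range = Nat.card (A →+ ZMod n) := by
    rw [hHom]
    rw [hA', ← hcard] at hrange
    exact Nat.eq_of_mul_eq_mul_right Nat.card_pos hrange
  -- so `Ψ` is onto
  haveI : Finite (A →+ ZMod n) := Nat.finite_of_card_ne_zero (by rw [hHom]; exact Nat.card_pos.ne')
  have htop : Ψ.range = ⊤ := AddSubgroup.eq_top_of_card_eq _ hcardR
  have hφ : φ ∈ Ψ.range := by rw [htop]; exact AddSubgroup.mem_top φ
  obtain ⟨b, hb⟩ := hφ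
  exact ⟨b, fun a ↦ by rw [← hΨ, hb]⟩

end Conjugate

end Literature.NumberTheory.EllipticCurves

end
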